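import Summits.CriticalPhenomena.SAWScalingLimit.Theorems.SAWDevelopingMapHexTransferCompassEndpointsFaceChains

/-!
# `ThirdBdryEndpoints` (line `yb-relay`, crux `HexTransfer`, stmt-CriticalPhenomena-14221): walks between prescribed end sides

Helper file (registered sub-goal `nonempty_ybWalk_of_reachable`) of the stub
`stub_thirdBdryEndpoints` of the line `yb-relay` for the crux
`Summit.CriticalPhenomena.SAWScalingLimit.Theses.SAWDevelopingMap.HexTransfer`
(stmt-CriticalPhenomena-14221). Pure combinatorics of the square grid of Glazman–Manolescu's
Yang–Baxter walks (`Literature.Probability.RandomPlanarGeometry.SAW.YangBaxter.YBWalk`),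
sharpening `…CompassEndpointsFaceChains` (which joins SOME sides of two joined faces) to
PRESCRIBED end sides:

* `exists_mids_of_faceChain_ends`: along a duplicate-free chain of adjacent faces `f₀, …, f_L`,
  given a side `e` of `f₀` bordering no later face and a side `e' ≠ e` of `f_L` bordering no
  earlier face, the list `e, c₁, …, c_L, e'` (`c_i` the common side of `f_{i-1}, f_i`) is
  duplicate-free and its `i`-th arc is drawn in `f_i` — so consecutive arcs lie in different
  faces and no face carries two arcs;
* **`nonempty_ybWalk_of_reachable`**: if `u, v` are joined in the adjacency graph of the faces
  of `S` (the `SimpleGraph.fromRel` relation of `…CompassEndpointsFaceChains`), `e` is a side of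
  `u` bordering no other face of `S` and `e'` a side of `v` bordering no other face of `S` (e.g.
  boundary edges of `S`), then a Yang–Baxter walk of `S` runs from `e` to `e'` (shorten a joining
  walk to a path, `SimpleGraph.Walk.bypass`; the trivial walk if `e = e'`).
-/

open Literature.Probability.RandomPlanarGeometry.SAW.YangBaxter

namespace Summit.CriticalPhenomena.SAWScalingLimit.Cruxes.HexTransfer.YbRelay

namespace ThirdEndpoints

/-- **The mid-edges crossed along a duplicate-free chain of adjacent faces, with prescribed end
sides**: given a side `e` of the first face bordering no later face of the chain and a side
`e' ≠ e` of the last face bordering no earlier face, a duplicate-free list `e :: m` ending at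
`e'`, all of whose mid-edges are sides of faces of the chain, whose arcs are drawn in faces of
the chain, consecutive ones in different faces, and no two in the same face (induction on the
chain: the new arc from `e` to the common side `c` of the first two faces is drawn in the first
face, which carries no other arc). Two-ended variant of
`Sketch.Endpoints.exists_mids_of_faceChain`. [folklore] -/
theorem exists_mids_of_faceChain_ends :
    ∀ (F : List Face) (hF : F ≠ []) (e e' : MidEdge),
      F.IsChain (fun f g => f ≠ g ∧ ∃ e : MidEdge, (∃ s, f.side s = e) ∧ ∃ t, g.side t = e) →
      F.Nodup →
      (∃ s, (F.head hF).side s = e) → (∀ x ∈ F.tail, ¬∃ s, x.side s = e) →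
      (∃ s, (F.getLast hF).side s = e') → (∀ x ∈ F.dropLast, ¬∃ s, x.side s = e') → e ≠ e' →
      ∃ m : List MidEdge, (e :: m).getLast? = some e' ∧ (e :: m).Nodup ∧
        (∀ e'' ∈ e :: m, ∃ x ∈ F, ∃ s, x.side s = e'') ∧
        (∀ p ∈ arcsOf (e :: m), ∃ x ∈ F, arcFace p = some x) ∧
        (arcsOf (e :: m)).IsChain (fun p q => arcFace p ≠ arcFace q) ∧
        (∀ p ∈ arcsOf (e :: m), ∀ q ∈ arcsOf (e :: m), arcFace p = arcFace q → p = q)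
  | [], hF, _, _, _, _, _, _, _, _, _ => absurd rfl hF
  | [f], _, e, e', _, _, he, _, he', _, hne => by
    obtain ⟨s, hs⟩ := he
    obtain ⟨t, ht⟩ := he'
    have hf : arcFace (e, e') = some f := by
      rw [arcFace, MidEdge.commonFace_eq_some_iff]
      exact ⟨hne, ⟨s, hs⟩, ⟨t, ht⟩⟩
    refine ⟨[e'], rfl, by simp [hne], ?_, ?_, ?_, ?_⟩
    · intro e'' h
      simp only [List.mem_cons, List.not_mem_nil, or_false] at h
      rcases h with rfl | rfl
      exacts [⟨f, List.mem_singleton_self f, s, hs⟩, ⟨f, List.mem_singleton_self f, t, ht⟩]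
    · intro p hp
      simp only [arcsOf, List.tail_cons, List.zip_cons_cons, List.zip_nil_right, List.mem_cons,
        List.not_mem_nil, or_false] at hp
      subst hp
      exact ⟨f, List.mem_singleton_self f, hf⟩
    · simp [arcsOf]
    · intro p hp q hq _
      simp only [arcsOf, List.tail_cons, List.zip_cons_cons, List.zip_nil_right, List.mem_cons,
        List.not_mem_nil, or_false] at hp hq
      rw [hp, hq]
  | f₀ :: f :: l, _, e, e', hc, hn, he, heno, he', he'no, hne => by
    obtain ⟨⟨hf₀f, c, hf₀c, hfc⟩, hc'⟩ := List.isChain_cons_cons.1 hc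
    have hf₀_notin : f₀ ∉ f :: l := (List.nodup_cons.1 hn).1
    have hf_notin : f ∉ l := (List.nodup_cons.1 hn.of_cons).1
    -- `c` borders no face of `l`, `e'` no face of `(f :: l).dropLast`, and `c ≠ e'`
    have hcno : ∀ x ∈ (f :: l).tail, ¬∃ s, x.side s = c := fun x hx hxc => by
      rcases Sketch.Endpoints.eq_or_eq_of_side_eq hf₀f hf₀c hfc hxc with rfl | rfl
      · exact hf₀_notin (List.mem_cons_of_mem _ hx)
      · exact hf_notin hx
    have hdl : (f₀ :: f :: l).dropLast = f₀ :: (f :: l).dropLast := List.dropLast_cons_cons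
    have he'no' : ∀ x ∈ (f :: l).dropLast, ¬∃ s, x.side s = e' := fun x hx =>
      he'no x (by rw [hdl]; exact List.mem_cons_of_mem _ hx)
    have hce' : c ≠ e' := fun h => he'no f₀ (by rw [hdl]; exact List.mem_cons_self) (h ▸ hf₀c)
    rw [List.getLast_cons_cons] at he'
    obtain ⟨m, hlast, hnd, hI1, hI2, hchain, hinj⟩ :=
      exists_mids_of_faceChain_ends (f :: l) (List.cons_ne_nil f l) c e' hc' hn.of_cons hfc hcno
        he' he'no' hce'
    -- the new arc `(e, c)` is drawn in `f₀`, the old ones in faces of `f :: l`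
    have he_notin : e ∉ c :: m := fun hmem => by
      obtain ⟨x, hx, hxe⟩ := hI1 e hmem
      exact heno x hx hxe
    have hec : e ≠ c := fun h => he_notin (h ▸ List.mem_cons_self)
    have hnew : arcFace (e, c) = some f₀ := by
      rw [arcFace, MidEdge.commonFace_eq_some_iff]
      exact ⟨hec, he, hf₀c⟩
    have hold : ∀ r ∈ arcsOf (c :: m), arcFace r ≠ some f₀ := fun r hr habs => by
      obtain ⟨x, hx, hrx⟩ := hI2 r hr
      rw [habs, Option.some_inj] at hrx
      subst hrx
      exact hf₀_notin hx
    have harcs_eq : arcsOf (e :: c :: m) = (e, c) :: arcsOf (c :: m) := rfl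
    refine ⟨c :: m, ?_, List.nodup_cons.2 ⟨he_notin, hnd⟩, ?_, ?_, ?_, ?_⟩
    · rw [List.getLast?_cons_cons]
      exact hlast
    · intro e'' he''
      rw [List.mem_cons] at he''
      rcases he'' with rfl | he''
      · exact ⟨f₀, List.mem_cons_self, he⟩
      · obtain ⟨x, hx, hxe⟩ := hI1 e'' he''
        exact ⟨x, List.mem_cons_of_mem _ hx, hxe⟩
    · intro p hp
      rw [harcs_eq, List.mem_cons] at hp
      rcases hp with rfl | hp
      · exact ⟨f₀, List.mem_cons_self, hnew⟩
      · obtain ⟨x, hx, hpx⟩ := hI2 p hp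
        exact ⟨x, List.mem_cons_of_mem _ hx, hpx⟩
    · rw [harcs_eq]
      refine List.IsChain.cons hchain fun q hq => ?_
      rw [hnew]
      exact fun habs => hold q (List.mem_of_mem_head? hq) habs.symm
    · intro p hp q hq hpq
      rw [harcs_eq, List.mem_cons] at hp hq
      rcases hp with rfl | hp <;> rcases hq with rfl | hq
      · rfl
      · exact absurd (hpq.symm.trans hnew) (hold q hq)
      · exact absurd (hpq.trans hnew) (hold p hp)
      · exact hinj p hp q hq hpq

end ThirdEndpoints

open ThirdEndpoints in
/-- **Faces joined inside `S` are joined by a Yang–Baxter walk of `S` between prescribed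
boundary sides** (registered sub-goal of the stub `stub_thirdBdryEndpoints`, line `yb-relay`,
crux `HexTransfer`): if `u, v` are joined in the adjacency graph of the faces of `S` (adjacent =
sharing a side, both in `S`), `u ∈ S`, `e` is a side of `u` bordering no other face of `S` and
`e'` a side of `v` bordering no other face of `S`, then a Yang–Baxter walk of `S` runs from `e`
to `e'` (`YBWalk S e e'`): shorten a joining walk to a path (`SimpleGraph.Walk.bypass`) and
cross its faces (`exists_mids_of_faceChain_ends`), the first arc drawn in `u`, the last in `v`;
the trivial walk if `e = e'`. [folklore] -/
theorem nonempty_ybWalk_of_reachable : ∀ (S : Set Face) (u v : Face), (SimpleGraph.fromRel fun f g : Face => (∃ e : MidEdge, (∃ s, f.side s = e) ∧ ∃ t, g.side t = e) ∧ f ∈ S ∧ g ∈ S).Reachable u v → u ∈ S → ∀ (e e' : MidEdge), (∃ s, u.side s = e) → (∀ x : Face, (∃ s, x.side s = e) → x ∈ S → x = u) → (∃ s, v.side s = e') → (∀ x : Face, (∃ s, x.side s = e') → x ∈ S → x = v) → Nonempty (YBWalk S e e') := by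
  classical
  intro S u v h hu e e' he heu he' hev
  by_cases hee : e = e'
  · subst hee
    exact ⟨YBWalk.trivial e⟩
  obtain ⟨p⟩ := h
  have hchain : p.bypass.support.IsChain (fun f g => f ≠ g ∧ ∃ e : MidEdge,
      (∃ s, f.side s = e) ∧ ∃ t, g.side t = e) := by
    refine p.bypass.isChain_adj_support.imp fun f g hfg => ?_
    obtain ⟨hne, h | h⟩ := (SimpleGraph.fromRel_adj _ _ _).1 hfg
    · exact ⟨hne, h.1⟩
    · obtain ⟨e, hg, hf⟩ := h.1
      exact ⟨hne, e, hf, hg⟩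
  have hnd : p.bypass.support.Nodup := p.bypass_isPath.support_nodup
  have hS : ∀ x ∈ p.bypass.support, x ∈ S := Sketch.Endpoints.forall_mem_support_mem p.bypass hu
  -- `e` borders no face of the tail of the path, `e'` none but the last
  have htail : ∀ x ∈ p.bypass.support.tail, ¬∃ s, x.side s = e := by
    intro x hx hxe
    have hxS : x ∈ S := hS x (List.mem_of_mem_tail hx)
    have hxu : x = u := heu x hxe hxS
    subst hxu
    have h' := hnd
    rw [← SimpleGraph.Walk.cons_tail_support] at h'
    exact (List.nodup_cons.1 h').1 hx
  have hdrop : ∀ x ∈ p.bypass.support.dropLast, ¬∃ s, x.side s = e' := by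
    intro x hx hxe
    have hxS : x ∈ S := hS x (List.dropLast_subset _ hx)
    have hxv : x = v := hev x hxe hxS
    subst hxv
    have h' := hnd
    rw [← List.dropLast_concat_getLast p.bypass.support_ne_nil, SimpleGraph.Walk.getLast_support,
      List.nodup_append] at h'
    exact h'.2.2 x hx x (List.mem_singleton_self x) rfl
  obtain ⟨m, hlast, hnd', -, hI2, hch, hinj⟩ := exists_mids_of_faceChain_ends p.bypass.support
    p.bypass.support_ne_nil e e' hchain hnd (by rw [SimpleGraph.Walk.head_support]; exact he)
    htail (by rw [SimpleGraph.Walk.getLast_support]; exact he') hdrop hee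
  refine ⟨⟨e :: m, rfl, hlast, hnd', fun q hq => ?_, hch, fun x h₁ h₂ => ?_⟩⟩
  · obtain ⟨x, hx, hqx⟩ := hI2 q hq
    exact ⟨x, hS x hx, hqx⟩
  · have key : ∀ p' q', p' ∈ arcsOf (e :: m) → q' ∈ arcsOf (e :: m) →
        arcFace p' = some x → arcFace q' = some x → p' = q' :=
      fun p' q' hp hq hpx hqx => hinj p' hp q' hq (hpx.trans hqx.symm)
    rcases h₁ with h₁ | h₁ <;> rcases h₂ with h₂ | h₂ <;>
      have := key _ _ h₁ h₂ (Sketch.Endpoints.arcFace_side_side x (by decide))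
        (Sketch.Endpoints.arcFace_side_side x (by decide)) <;>
      simp [Face.side] at this

end Summit.CriticalPhenomena.SAWScalingLimit.Cruxes.HexTransfer.YbRelay
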